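import Literature.Combinatorics.SimpleGraph.GraphAutomorphismsOneForms
import Literature.Combinatorics.SimpleGraph.HyperellipticInvolutionOneForms
import HarnessLib

/-!
# Theorem 58 for an arbitrary automorphism: `ι^* = −1` on `𝓗¹(G)` makes `ι` the hyperelliptic
# involution (Baker–Norine 2009, Theorem 58 via Proposition 36)

Source (held, read at the page; statements VERBATIM). M. Baker, S. Norine, *Harmonic morphisms
and hyperelliptic graphs*, Int. Math. Res. Not. IMRN 2009 [BakerNorine2009] (held text
`paper:arxiv-0707.1309`, chunks p0019–p0020), §5.3: «**Theorem 58.** Let `G` be a 2-edge-connected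
graph of genus `g ≥ 2`, and let `ι ∈ Aut(G)`. The following are equivalent: (1) `G` is
hyperelliptic with hyperelliptic involution `ι`. (2) `ι_* : Jac(G) → Jac(G)` is multiplication
by `−1`. (3) `ι^* : Jac(G) → Jac(G)` is multiplication by `−1`. (4) `ι_* : 𝓗¹(G) → 𝓗¹(G)` is
multiplication by `−1`. (5) `ι^* : 𝓗¹(G) → 𝓗¹(G)` is multiplication by `−1`.» Proof of
(5) ⇒ (1): «Suppose `ι^* = −1` on `𝓗¹(G)`. Then `(ι²)^* = Id` on `𝓗¹(G)`. By
Proposition 36, it follows that `ι²` is the identity map on `G`, i.e., `ι` is an involution. We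
claim that `ι` is mixing. […] letting `ω` be the characteristic function of any simple cycle
containing `e`, we have `ω(e) = ω(ι(e)) = (ι^*ω)(e) = −ω(e)`, so that `ω(e) = 0`, a
contradiction. […] Let `G′ = G/⟨ι⟩` […] `G′` is a tree.» «Since `ι` is a harmonic morphism of
degree `1` from `G` to itself, `ι_* ∘ ι^*` is the identity map on both `Jac(G)` and `𝓗¹(G)`. It
follows easily that (2) ⇔ (3) and (4) ⇔ (5).»

The lineage file `HyperellipticInvolutionOneForms` types (5) ⇒ (1) and (1) ⇔ (2) ⇔ (3) ⇔ (5)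
for an involutive automorphism with simple edge orbits GIVEN (`IsInvolutiveAut G ι`,
`HasSimpleEdgeOrbits G ι`; its caveat (d)). With Proposition 36 (`GraphAutomorphismsOneForms`)
both hypotheses are now DERIVED from (5) for an arbitrary `ι ∈ Aut(G)` (`ι : G ≃g G`), as printed.

## What is formalised (`K` an ordered field, e.g. `ℝ`; B–N's `𝓗¹(G) = H¹(G, ℝ)`)

* `isInvolutiveAut_of_forall_flow`: (5) ⇒ `ι² = 1` («By Proposition 36 […] `ι` is an
  involution»);
* `hasSimpleEdgeOrbits_of_forall_flow`: (5) ⇒ the edge orbits of `ι` are simple (no 4-cycle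
  `x, y, ι x, ι y` — the simple-graph shadow of «`G′` has no multiple edges», by the same
  cycle-flow contradiction as the printed mixing step; any characteristic-`0` domain);
* **Theorem 58 (5) ⇒ (1)** `isTreeInvolution_of_forall_flow` (`ι` is an involution with simple
  edge orbits and `G/ι` is a tree), `isHyperelliptic_of_forall_flow_neg` (`G` is hyperelliptic) and
  `eq_hypInvolution_of_forall_flow` (`ι` is the hyperelliptic involution `hypInvolution G D` of
  every degree-`2` class `D` with `r(D) = 1`);
* **Theorem 58 (1) ⇔ (5), (2) ⇔ (5), (3) ⇔ (5), (4) ⇔ (5) for an arbitrary `ι ∈ Aut(G)`**: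
  `isTreeInvolution_iff_forall_flow`, `jacPushforward_eq_neg_iff_forall_flow_neg`,
  `jacPullback_eq_neg_iff_forall_flow_neg`, `forall_cochainPushforward_eq_neg_iff`.

Theorems only (plus two unfolding lemmas on `ofEdgeVec`); no `sorry`; no named facts; no
instances.
-/

open Finset SimpleGraph Matrix
open Literature.Combinatorics.SimpleGraph.ChipFiring
open Literature.Combinatorics.SimpleGraph.OrientedIncidence

namespace Literature.Combinatorics.SimpleGraph.BakerNorine

variable {V : Type*} [Fintype V] [DecidableEq V] {G : SimpleGraph V} [DecidableRel G.Adj]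
variable {R : Type*} [CommRing R]

/-! ### §1 The flow of a cycle is `+1` along each of its darts -/

omit [Fintype V] in
/-- `ofEdgeVec` is additive. [cite: BakerNorine2009, §4.3 (1-cochains)] -/
theorem ofEdgeVec_add (σ : Orientation G) (x y : G.edgeSet → R) :
    ofEdgeVec σ (x + y) = ofEdgeVec σ x + ofEdgeVec σ y := by
  funext u v
  simp only [Pi.add_apply]
  by_cases h : G.Adj u v
  · by_cases hh : σ.head ⟨s(u, v), h⟩ = v
    · rw [ofEdgeVec_apply_of_head_eq σ _ h hh, ofEdgeVec_apply_of_head_eq σ _ h hh,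
        ofEdgeVec_apply_of_head_eq σ _ h hh, Pi.add_apply]
    · rw [ofEdgeVec_apply_of_head_ne σ _ h hh, ofEdgeVec_apply_of_head_ne σ _ h hh,
        ofEdgeVec_apply_of_head_ne σ _ h hh, Pi.add_apply, neg_add]
  · rw [ofEdgeVec_apply_of_not_adj σ _ h, ofEdgeVec_apply_of_not_adj σ _ h,
      ofEdgeVec_apply_of_not_adj σ _ h, add_zero]

omit [Fintype V] in
/-- **The signed indicator of a dart, read as a 1-cochain, is `+1` on that dart** (whatever the
orientation). [cite: BakerNorine2009, Theorem 58 (proof of (5) ⇒ (1): «the characteristic function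
of any simple cycle»)] -/
theorem ofEdgeVec_dartVec_apply (σ : Orientation G) {u v : V} (h : G.Adj u v) :
    ofEdgeVec σ (σ.dartVec R ⟨(u, v), h⟩) u v = 1 := by
  have hd : σ.dartVec R ⟨(u, v), h⟩ ⟨s(u, v), h⟩ = if σ.head ⟨s(u, v), h⟩ = v then 1 else -1 :=
    σ.dartVec_apply_self (R := R) ⟨(u, v), h⟩
  by_cases hh : σ.head ⟨s(u, v), h⟩ = v
  · rw [ofEdgeVec_apply_of_head_eq σ _ h hh, hd, if_pos hh]
  · rw [ofEdgeVec_apply_of_head_ne σ _ h hh, hd, if_neg hh, neg_neg]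

omit [Fintype V] in
/-- The signed indicator of a dart vanishes, as a 1-cochain, on every other edge. [cite:
BakerNorine2009, Theorem 58 (proof of (5) ⇒ (1))] -/
theorem ofEdgeVec_dartVec_apply_of_ne (σ : Orientation G) {u v a b : V} (h : G.Adj u v)
    (hab : G.Adj a b) (hne : s(a, b) ≠ s(u, v)) :
    ofEdgeVec σ (σ.dartVec R ⟨(u, v), h⟩) a b = 0 := by
  have h0 : σ.dartVec R ⟨(u, v), h⟩ ⟨s(a, b), hab⟩ = 0 := σ.dartVec_apply_of_ne hne
  by_cases hh : σ.head ⟨s(a, b), hab⟩ = b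
  · rw [ofEdgeVec_apply_of_head_eq σ _ hab hh, h0]
  · rw [ofEdgeVec_apply_of_head_ne σ _ hab hh, h0, neg_zero]

/-! ### §2 (5) ⇒ the edge orbits of `ι` are simple -/

/-- **(5) ⇒ simple edge orbits**: if `ι` is an involutive automorphism with `ι^*ω = −ω` for every
flow `ω` (values in a characteristic-`0` domain), then no two `ι`-orbits of edges join the same pair
of vertex orbits — else `x ∼ y`, `x ∼ ι(y)` with `x, y` not fixed give the 4-cycle `x, y, ι(x),
ι(y)`, which `ι` rotates by two steps, and its characteristic flow `ω` has `ω(ι(e)) = ω(e) = 1`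
against `(ι^*ω)(e) = −ω(e)`. [cite: BakerNorine2009, Theorem 58 (proof of (5) ⇒ (1): «`ω(e) =
ω(ι(e)) = (ι^*ω)(e) = −ω(e)`, so that `ω(e) = 0`, a contradiction»)] -/
theorem hasSimpleEdgeOrbits_of_forall_flow [IsDomain R] [CharZero R] {ι : V → V}
    (hι : IsInvolutiveAut G ι)
    (h5 : ∀ ω : V → V → R, IsGraphFlow G ω → ∀ u x, ω (ι u) (ι x) = -ω u x) :
    HasSimpleEdgeOrbits G ι := by
  intro x y hxy hxy' 
  by_contra hcon
  rw [not_or] at hcon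
  obtain ⟨hx, hy⟩ := hcon
  -- the 4-cycle `x → y → ι x → ι y → x`
  have h2 : G.Adj y (ι x) := by
    have h := hι.map_adj hxy'
    rw [hι.apply_apply] at h
    exact h.symm
  have h3 : G.Adj (ι x) (ι y) := hι.map_adj hxy
  have h4 : G.Adj (ι y) x := hxy'.symm
  set σ := someOrientation G
  let c : G.Walk x x := Walk.cons hxy (Walk.cons h2 (Walk.cons h3 (Walk.cons h4 Walk.nil)))
  set ω : V → V → R := ofEdgeVec σ (σ.walkVec R c) with hω
  have hflow : IsGraphFlow G ω := isGraphFlow_ofEdgeVec_walkVec σ c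
  have hvec : σ.walkVec R c = σ.dartVec R ⟨(x, y), hxy⟩ + (σ.dartVec R ⟨(y, ι x), h2⟩ +
      (σ.dartVec R ⟨(ι x, ι y), h3⟩ + (σ.dartVec R ⟨(ι y, x), h4⟩ + 0))) := by
    simp only [c, σ.walkVec_cons, σ.walkVec_nil]
  -- the edges of the cycle other than `xy` (resp. `ι(x)ι(y)`) differ from it
  have hxιy : x ≠ ι y := hxy'.ne
  have hyιx : y ≠ ι x := h2.ne
  have e12 : s(x, y) ≠ s(y, ι x) := by
    rw [Ne, Sym2.eq_iff]; rintro (⟨rfl, -⟩ | ⟨h, -⟩); exacts [hxy.ne rfl, hx h.symm]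
  have e13 : s(x, y) ≠ s(ι x, ι y) := by
    rw [Ne, Sym2.eq_iff]; rintro (⟨h, -⟩ | ⟨h, -⟩); exacts [hx h.symm, hxιy h]
  have e14 : s(x, y) ≠ s(ι y, x) := by
    rw [Ne, Sym2.eq_iff]; rintro (⟨h, -⟩ | ⟨-, h⟩); exacts [hxιy h, hy h.symm]
  have e32 : s(ι x, ι y) ≠ s(y, ι x) := by
    rw [Ne, Sym2.eq_iff]; rintro (⟨h, -⟩ | ⟨-, h⟩); exacts [hyιx h.symm, hy h]
  have e34 : s(ι x, ι y) ≠ s(ι y, x) := by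
    rw [Ne, Sym2.eq_iff]; rintro (⟨-, h⟩ | ⟨h, -⟩); exacts [hxιy h.symm, hx h]
  have hω1 : ω x y = 1 := by
    rw [hω, hvec, add_zero, ofEdgeVec_add, ofEdgeVec_add, ofEdgeVec_add, Pi.add_apply,
      Pi.add_apply, Pi.add_apply, Pi.add_apply, Pi.add_apply, Pi.add_apply,
      ofEdgeVec_dartVec_apply, ofEdgeVec_dartVec_apply_of_ne σ h2 hxy e12,
      ofEdgeVec_dartVec_apply_of_ne σ h3 hxy e13, ofEdgeVec_dartVec_apply_of_ne σ h4 hxy e14]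
    ring
  have hω3 : ω (ι x) (ι y) = 1 := by
    rw [hω, hvec, add_zero, ofEdgeVec_add, ofEdgeVec_add, ofEdgeVec_add, Pi.add_apply,
      Pi.add_apply, Pi.add_apply, Pi.add_apply, Pi.add_apply, Pi.add_apply,
      ofEdgeVec_dartVec_apply_of_ne σ hxy h3 e13.symm, ofEdgeVec_dartVec_apply_of_ne σ h2 h3 e32,
      ofEdgeVec_dartVec_apply, ofEdgeVec_dartVec_apply_of_ne σ h4 h3 e34]
    ring
  have h := h5 ω hflow x y
  rw [hω1, hω3] at h
  norm_num at h

/-! ### §3 (5) ⇒ `ι` is an involution (Proposition 36) -/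

variable (K : Type*) [Field K] [LinearOrder K] [IsStrictOrderedRing K]

omit [Fintype V] [DecidableEq V] [LinearOrder K] [IsStrictOrderedRing K] in
/-- `(ι²)^*ω = ω` when `ι^*ω = −ω` pointwise. [cite: BakerNorine2009, Theorem 58 (proof of (5) ⇒
(1): «Then `(ι²)^* = Id` on `𝓗¹(G)`»)] -/
theorem cochainPullback_mul_self_eq (ι : G ≃g G) {ω : V → V → K} (hω : IsOneCochain G ω)
    (h : ∀ u x, ω (ι u) (ι x) = -ω u x) : cochainPullback G ⇑(ι * ι) ω = ω := by
  funext u x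
  rw [cochainPullback_apply]
  by_cases hux : G.Adj u x
  · rw [if_pos hux, RelIso.mul_apply, RelIso.mul_apply, h, h, neg_neg]
  · rw [if_neg hux, hω.eq_zero_of_not_adj hux]

/-- **(5) ⇒ `ι` is an involution**: «Suppose `ι^* = −1` on `𝓗¹(G)`. Then `(ι²)^* = Id` on `𝓗¹(G)`.
By Proposition 36, it follows that `ι²` is the identity map on `G`, i.e., `ι` is an involution.»
[cite: BakerNorine2009, Theorem 58 (proof of (5) ⇒ (1)), Proposition 36] -/
theorem mul_self_eq_one_of_forall_flow (h2 : G.IsEdgeConnected 2) (hg : 2 ≤ genus G) (ι : G ≃g G)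
    (h5 : ∀ ω : V → V → K, IsGraphFlow G ω → ∀ u x, ω (ι u) (ι x) = -ω u x) : ι * ι = 1 :=
  eq_one_of_cochainPullback_eq_self K h2 hg (ι * ι) fun ω hω =>
    cochainPullback_mul_self_eq K ι hω.toIsOneCochain (h5 ω hω)

/-- **(5) ⇒ `ι` is an involutive automorphism** (the tree's `IsInvolutiveAut`). [cite:
BakerNorine2009, Theorem 58 (proof of (5) ⇒ (1)), Proposition 36] -/
theorem isInvolutiveAut_of_forall_flow (h2 : G.IsEdgeConnected 2) (hg : 2 ≤ genus G) (ι : G ≃g G)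
    (h5 : ∀ ω : V → V → K, IsGraphFlow G ω → ∀ u x, ω (ι u) (ι x) = -ω u x) :
    IsInvolutiveAut G ι where
  involutive x := by
    have h := congr_arg (fun γ : G ≃g G => γ x) (mul_self_eq_one_of_forall_flow K h2 hg ι h5)
    simpa only [RelIso.mul_apply, RelIso.one_apply] using h
  map_adj := fun _ _ h => ι.map_adj_iff.2 h

/-! ### §4 Theorem 58 for an arbitrary automorphism -/

/-- **Theorem 58, (5) ⇒ (1)** for `ι ∈ Aut(G)`: if `G` is 2-edge-connected of genus `≥ 2` and `ι^*ω
= −ω` for every flow `ω ∈ H¹(G, K)`, then `ι` is an involution with simple edge orbits whose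
quotient `G/⟨ι⟩` is a tree («`G′` is a tree, and since `φ : G → G′` is a non-degenerate harmonic
morphism of degree `2`, we conclude that `G` is hyperelliptic»). [cite: BakerNorine2009, Theorem 58
((5) ⇒ (1))] -/
theorem isTreeInvolution_of_forall_flow (h2 : G.IsEdgeConnected 2) (hg : 2 ≤ genus G) (ι : G ≃g G)
    (h5 : ∀ ω : V → V → K, IsGraphFlow G ω → ∀ u x, ω (ι u) (ι x) = -ω u x) :
    IsInvolutiveAut G ι ∧ (quotientGraph G ι).IsTree ∧ HasSimpleEdgeOrbits G ι := by
  haveI : Nontrivial V := nontrivial_of_two_le_genus hg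
  have hG : G.Connected := h2.connected (by norm_num)
  have hι := isInvolutiveAut_of_forall_flow K h2 hg ι h5
  have hs := hasSimpleEdgeOrbits_of_forall_flow hι h5
  exact ⟨hι, isTree_quotientGraph_of_forall_flow hG h2 hι hs h5, hs⟩

/-- **Theorem 58, (5) ⇒ `G` is hyperelliptic** for an arbitrary `ι ∈ Aut(G)`. [cite:
BakerNorine2009, Theorem 58 ((5) ⇒ (1))] -/
theorem isHyperelliptic_of_forall_flow_neg (h2 : G.IsEdgeConnected 2) (hg : 2 ≤ genus G)
    (ι : G ≃g G) (h5 : ∀ ω : V → V → K, IsGraphFlow G ω → ∀ u x, ω (ι u) (ι x) = -ω u x) :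
    IsHyperelliptic G := by
  haveI : Nontrivial V := nontrivial_of_two_le_genus hg
  have hG : G.Connected := h2.connected (by norm_num)
  obtain ⟨hι, hT, hs⟩ := isTreeInvolution_of_forall_flow K h2 hg ι h5
  exact isHyperelliptic_of_isTree_quotientGraph hG h2 (two_lt_card_of_two_le_genus hG hg) hι hT hs hg

/-- **Theorem 58, (5) ⇒ «hyperelliptic with hyperelliptic involution `ι`»**: under (5), `ι` is the
involution `hypInvolution G D` of every divisor `D` of degree `2` with `r(D) ≥ 1` (the hyperelliptic
involution of §5.1, unique by Corollary 54). [cite: BakerNorine2009, Theorem 58 ((5) ⇒ (1)),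
Corollary 53, Remark 56] -/
theorem eq_hypInvolution_of_forall_flow (h2 : G.IsEdgeConnected 2) (hg : 2 ≤ genus G)
    (ι : G ≃g G) (h5 : ∀ ω : V → V → K, IsGraphFlow G ω → ∀ u x, ω (ι u) (ι x) = -ω u x)
    {D : V → ℤ} (hD : ∑ v, D v = 2) (hr : 1 ≤ rank G D) (x : V) : ι x = hypInvolution G D x := by
  haveI : Nontrivial V := nontrivial_of_two_le_genus hg
  have hG : G.Connected := h2.connected (by norm_num)
  obtain ⟨hι, hT, hs⟩ := isTreeInvolution_of_forall_flow K h2 hg ι h5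
  exact eq_hypInvolution_of_isTree_quotientGraph hG h2 (two_lt_card_of_two_le_genus hG hg) hι hT hs
    hg hD hr x

/-- **Theorem 58 (1) ⇔ (5)** for an arbitrary `ι ∈ Aut(G)` of a 2-edge-connected graph of genus `≥
2`: `ι` is an involution with simple edge orbits and tree quotient iff `ι^* = −1` on `H¹(G, K)`.
[cite: BakerNorine2009, Theorem 58 ((1) ⇔ (5))] -/
theorem isTreeInvolution_iff_forall_flow (h2 : G.IsEdgeConnected 2) (hg : 2 ≤ genus G)
    (ι : G ≃g G) :
    (IsInvolutiveAut G ι ∧ (quotientGraph G ι).IsTree ∧ HasSimpleEdgeOrbits G ι) ↔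
      ∀ ω : V → V → K, IsGraphFlow G ω → ∀ u x, ω (ι u) (ι x) = -ω u x :=
  ⟨fun h _ hω u x => hω.apply_tree_involution h2 h.1 h.2.1 h.2.2 u x,
    isTreeInvolution_of_forall_flow K h2 hg ι⟩

/-- **Theorem 58 (2) ⇔ (5)** for an arbitrary `ι ∈ Aut(G)`: `ι_* = −1` on `Jac(G)` iff `ι^* = −1` on
`H¹(G, K)`. [cite: BakerNorine2009, Theorem 58 ((2) ⇔ (5))] -/
theorem jacPushforward_eq_neg_iff_forall_flow_neg (h2 : G.IsEdgeConnected 2) (hg : 2 ≤ genus G)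
    (ι : G ≃g G) :
    (∀ c : criticalGroup G, (isHarmonicMorphism_iso ι).jacPushforward c = -c) ↔
      ∀ ω : V → V → K, IsGraphFlow G ω → ∀ u x, ω (ι u) (ι x) = -ω u x := by
  haveI : Nontrivial V := nontrivial_of_two_le_genus hg
  have hG : G.Connected := h2.connected (by norm_num)
  rw [← isTree_quotientGraph_iff_jacPushforward_eq_neg hG h2 hg ι,
    isTreeInvolution_iff_forall_flow K h2 hg ι]

/-- **Theorem 58 (3) ⇔ (5)** for an arbitrary `ι ∈ Aut(G)`: `ι^* = −1` on `Jac(G)` iff `ι^* = −1` on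
`H¹(G, K)`. [cite: BakerNorine2009, Theorem 58 ((3) ⇔ (5))] -/
theorem jacPullback_eq_neg_iff_forall_flow_neg (hG : G.Connected) (h2 : G.IsEdgeConnected 2)
    (hg : 2 ≤ genus G) (ι : G ≃g G) :
    (∀ c : criticalGroup G, (isHarmonicMorphism_iso ι).jacPullback hG c = -c) ↔
      ∀ ω : V → V → K, IsGraphFlow G ω → ∀ u x, ω (ι u) (ι x) = -ω u x := by
  rw [← isTree_quotientGraph_iff_jacPullback_eq_neg hG h2 hg ι,
    isTreeInvolution_iff_forall_flow K h2 hg ι]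

/-! ### §5 (4) ⇔ (5) for an arbitrary automorphism -/

omit [LinearOrder K] [IsStrictOrderedRing K] in
/-- `ι_*ω` for an automorphism `ι`: `(ι_*ω)(a, b) = ω(ι⁻¹ a, ι⁻¹ b)` (the fibres of `ι` are the
singletons `{ι⁻¹ a}`). [cite: BakerNorine2009, §4.3 («`φ_*ω(e′) := Σ_{φ(e) = e′} ω(e)`»)] -/
theorem cochainPushforward_iso_apply (ι : G ≃g G) {ω : V → V → K} (hω : IsOneCochain G ω)
    (a b : V) : cochainPushforward G ι ω a b = ω (ι⁻¹ a) (ι⁻¹ b) := by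
  have hfib : ∀ v, univ.filter (fun y => ι y = v) = {ι⁻¹ v} := fun v => by
    ext y
    rw [mem_filter, mem_singleton, and_iff_right (mem_univ _)]
    constructor
    · rintro rfl
      exact (RelIso.inv_apply_self ι y).symm
    · rintro rfl
      exact RelIso.apply_inv_self ι v
  rw [cochainPushforward_apply, hfib a, hfib b, sum_singleton, sum_singleton]
  by_cases hab : G.Adj a b
  · rw [if_pos hab]
  · rw [if_neg hab, hω.eq_zero_of_not_adj fun h' => hab ?_]
    have h'' := ι.map_adj_iff.2 h'
    rwa [RelIso.apply_inv_self, RelIso.apply_inv_self] at h''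

omit [LinearOrder K] [IsStrictOrderedRing K] in
/-- **Theorem 58 (4) ⇔ (5)** for an arbitrary `ι ∈ Aut(G)`: `ι_* = −1` on the flows iff `ι^* = −1`
(«`ι_* ∘ ι^*` is the identity map […] It follows easily that (4) ⇔ (5)»). [cite: BakerNorine2009,
Theorem 58 ((4) ⇔ (5))] -/
theorem forall_cochainPushforward_eq_neg_iff (ι : G ≃g G) :
    (∀ ω : V → V → K, IsGraphFlow G ω → cochainPushforward G ι ω = -ω) ↔
      ∀ ω : V → V → K, IsGraphFlow G ω → ∀ u x, ω (ι u) (ι x) = -ω u x := by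
  constructor
  · intro h ω hω u x
    have h' := congr_fun (congr_fun (h ω hω) (ι u)) (ι x)
    rw [cochainPushforward_iso_apply K ι hω.toIsOneCochain, RelIso.inv_apply_self,
      RelIso.inv_apply_self, Pi.neg_apply, Pi.neg_apply] at h'
    rw [← neg_neg (ω (ι u) (ι x)), ← h']
  · intro h ω hω
    funext a b
    rw [cochainPushforward_iso_apply K ι hω.toIsOneCochain, Pi.neg_apply, Pi.neg_apply]
    have h' := h ω hω (ι⁻¹ a) (ι⁻¹ b)
    rw [RelIso.apply_inv_self, RelIso.apply_inv_self] at h'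
    rw [← neg_neg (ω (ι⁻¹ a) (ι⁻¹ b)), ← h']

end Literature.Combinatorics.SimpleGraph.BakerNorine

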